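import Summits.Ventures.DiscreteObjects.UnitDistance.MoserLocalReduction
import Mathlib.LinearAlgebra.Dimension.Finrank
import Mathlib.Tactic

/-!
# Residues in `ℚ₂(√2, i) = ℚ₂(ζ₈)` are `0` or `1` — by a dimension count (cell `pub-namedobj`, target (U), seat udg g10)

Framing (verbatim for the cell): lottery ticket; floor = certified bounds/negative ranges.

Tool file for U4 (`χ(ℚ(√2,√3)²) = 4`).  Inside a field `Ω ⊇ ℚ₂` with `I² = −1`, `s2² = 2` and `ℚ₂`-automorphisms `σ : I ↦ −I`
(fixing `s2`) and `ρ : s2 ↦ −s2` (fixing `I`), the element `π = s2(1+I)/2 − 1 = ζ₈ − 1` has `‖π‖⁴ = ‖2‖` (product of its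
four conjugates is `Φ₈(1) = 2`).  MAIN LEMMA `spN_lt_or_sub_one_lt_of_coeffs`: every `y = a + b·s2 + c·I + d·s2·I`
(`a b c d ∈ ℚ₂`) of spectral norm `≤ 1` satisfies `‖y‖ < 1` or `‖y − 1‖ < 1` (its residue is `0` or `1`).  Proof without
naming the residue field: otherwise `‖y‖ = ‖y − 1‖ = ‖y + 1‖ = 1`, and then the eight vectors `π^j, y·π^j (j < 4)` would be
`ℚ₂`-linearly independent (an ultrametric sum `Σ (c_j + d_j y) π^j` has norm `max_j max(‖c_j‖,‖d_j‖)·‖π‖^j`, the nonzero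
terms having pairwise distinct norms `2^{−v−j/4}`), impossible inside the `4`-dimensional coefficient space.  Nothing here is literature.
-/

noncomputable section

namespace Summit.Ventures.DiscreteObjects.UnitDistance.MoserLocal

open Spectral

/-- Local data for `ℚ₂(√2, i)`: `I`, `s2` and the two automorphisms. -/
structure Zeta8Data (Ω : Type*) [Field Ω] [Algebra ℚ_[2] Ω] where
  /-- a square root of `-1` -/
  I : Ω
  /-- a square root of `2` -/
  s2 : Ω
  /-- `I² = -1` -/
  hI : I ^ 2 = -1
  /-- `s2² = 2` -/
  hs2 : s2 ^ 2 = 2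
  /-- the automorphism negating `I`, fixing `s2` -/
  σ : Ω ≃ₐ[ℚ_[2]] Ω
  /-- the automorphism negating `s2`, fixing `I` -/
  ρ : Ω ≃ₐ[ℚ_[2]] Ω
  /-- `σ I = -I` -/
  σI : σ I = -I
  /-- `σ s2 = s2` -/
  σs2 : σ s2 = s2
  /-- `ρ I = I` -/
  ρI : ρ I = I
  /-- `ρ s2 = -s2` -/
  ρs2 : ρ s2 = -s2

variable {Ω : Type*} [Field Ω] [CharZero Ω] [Algebra ℚ_[2] Ω] [Algebra.IsAlgebraic ℚ_[2] Ω] (Z : Zeta8Data Ω)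

/-- The evaluation of a coefficient vector: `ev w = w₀ + w₁ s2 + w₂ I + w₃ s2 I`. -/
def Zeta8Data.ev (w : Fin 4 → ℚ_[2]) : Ω :=
  algebraMap ℚ_[2] Ω (w 0) + algebraMap ℚ_[2] Ω (w 1) * Z.s2 + algebraMap ℚ_[2] Ω (w 2) * Z.I +
    algebraMap ℚ_[2] Ω (w 3) * (Z.s2 * Z.I)

omit [CharZero Ω] [Algebra.IsAlgebraic ℚ_[2] Ω] in
/-- `ev` is additive. -/
theorem Zeta8Data.ev_add (w w' : Fin 4 → ℚ_[2]) : Z.ev (w + w') = Z.ev w + Z.ev w' := by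
  simp only [Zeta8Data.ev, Pi.add_apply, map_add]; ring

omit [CharZero Ω] [Algebra.IsAlgebraic ℚ_[2] Ω] in
/-- `ev` is `ℚ₂`-homogeneous. -/
theorem Zeta8Data.ev_smul (c : ℚ_[2]) (w : Fin 4 → ℚ_[2]) : Z.ev (c • w) = algebraMap ℚ_[2] Ω c * Z.ev w := by
  simp only [Zeta8Data.ev, Pi.smul_apply, smul_eq_mul, map_mul]; ring

omit [CharZero Ω] [Algebra.IsAlgebraic ℚ_[2] Ω] in
/-- `ev` of a finite linear combination. -/
theorem Zeta8Data.ev_sum {ι : Type*} (s : Finset ι) (g : ι → ℚ_[2]) (w : ι → Fin 4 → ℚ_[2]) :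
    Z.ev (∑ k ∈ s, g k • w k) = ∑ k ∈ s, algebraMap ℚ_[2] Ω (g k) * Z.ev (w k) := by
  classical
  induction s using Finset.induction_on with
  | empty => simp [Zeta8Data.ev]
  | insert a s ha ih => rw [Finset.sum_insert ha, Finset.sum_insert ha, Zeta8Data.ev_add, Zeta8Data.ev_smul, ih]

/-- `π = ζ₈ − 1` with `ζ₈ = s2 (1 + I)/2`. -/
def Zeta8Data.pi : Ω := Z.s2 * (1 + Z.I) / 2 - 1

/-- Multiplication by `π` on coefficient vectors (basis `1, s2, I, s2 I`). -/
def mulPi8 (w : Fin 4 → ℚ_[2]) : Fin 4 → ℚ_[2] :=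
  ![-w 0 + w 1 - w 3, w 0 / 2 - w 1 - w 2 / 2, w 1 - w 2 + w 3, w 0 / 2 + w 2 / 2 - w 3]

omit [Algebra.IsAlgebraic ℚ_[2] Ω] in
/-- `ev (mulPi8 w) = ev w * π`. -/
theorem Zeta8Data.ev_mulPi (w : Fin 4 → ℚ_[2]) : Z.ev (mulPi8 w) = Z.ev w * Z.pi := by
  have e0 : mulPi8 w 0 = -w 0 + w 1 - w 3 := rfl
  have e1 : mulPi8 w 1 = w 0 / 2 - w 1 - w 2 / 2 := rfl
  have e2 : mulPi8 w 2 = w 1 - w 2 + w 3 := rfl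
  have e3 : mulPi8 w 3 = w 0 / 2 + w 2 / 2 - w 3 := rfl
  simp only [Zeta8Data.ev, Zeta8Data.pi, e0, e1, e2, e3, map_add, map_sub, map_neg, map_div₀, map_ofNat]
  linear_combination (-(algebraMap ℚ_[2] Ω (w 1) + algebraMap ℚ_[2] Ω (w 3)) * Z.I / 2
      - algebraMap ℚ_[2] Ω (w 1) / 2 - algebraMap ℚ_[2] Ω (w 3) * Z.I ^ 2 / 2) * Z.hs2 +
    (-(algebraMap ℚ_[2] Ω (w 2) / 2) * Z.s2 - algebraMap ℚ_[2] Ω (w 3)) * Z.hI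

omit [Algebra.IsAlgebraic ℚ_[2] Ω] in
/-- Iterates: `ev (mulPi8^[j] w) = ev w * π ^ j`. -/
theorem Zeta8Data.ev_mulPi_iterate (w : Fin 4 → ℚ_[2]) (j : ℕ) : Z.ev (mulPi8^[j] w) = Z.ev w * Z.pi ^ j := by
  induction j with
  | zero => simp
  | succ j ih => rw [Function.iterate_succ_apply', Zeta8Data.ev_mulPi, ih, pow_succ, mul_assoc]

omit [CharZero Ω] in
/-- `‖I‖ = 1`. -/
theorem Zeta8Data.spN_I : spN ℚ_[2] Z.I = 1 := by
  have h : spN ℚ_[2] Z.I ^ 2 = 1 := by rw [← spN_pow, Z.hI, spN_neg, spN_one]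
  have h0 := spN_nonneg ℚ_[2] Z.I
  nlinarith [h, h0]

/-- THE UNIFORMISER: `‖π‖ ^ 4 = 1/2` (the four conjugates of `π` multiply to `Φ₈(1) = 2`). -/
theorem Zeta8Data.spN_pi_pow_four : spN ℚ_[2] Z.pi ^ 4 = 2⁻¹ := by
  -- the four conjugates
  have c1 : Z.σ Z.pi = Z.s2 * (1 - Z.I) / 2 - 1 := by
    rw [Zeta8Data.pi, map_sub, map_div₀, map_mul, map_add, map_one, map_ofNat, Z.σI, Z.σs2, ← sub_eq_add_neg]
  have c2 : Z.ρ Z.pi = -Z.s2 * (1 + Z.I) / 2 - 1 := by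
    rw [Zeta8Data.pi, map_sub, map_div₀, map_mul, map_add, map_one, map_ofNat, Z.ρI, Z.ρs2, neg_mul]
  have c3 : Z.ρ (Z.σ Z.pi) = -Z.s2 * (1 - Z.I) / 2 - 1 := by
    rw [c1, map_sub, map_div₀, map_mul, map_sub, map_one, map_ofNat, Z.ρI, Z.ρs2, neg_mul]
  have hprod : Z.pi * Z.σ Z.pi * Z.ρ Z.pi * Z.ρ (Z.σ Z.pi) = 2 := by
    rw [c3, c1, c2, Zeta8Data.pi]
    -- (ζ-1)(-ζ-1) = 1 - ζ² = 1 - I and (ζ'-1)(-ζ'-1) = 1 - ζ'² = 1 + I, product 2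
    linear_combination ((Z.s2 ^ 2 + 2) * (1 - Z.I ^ 2) ^ 2 / 16) * Z.hs2 +
      ((Z.I ^ 2 - 3) / 4 - Z.s2 ^ 2 / 2) * Z.hI
  have hn := congrArg (spN ℚ_[2]) hprod
  rw [spN_mul, spN_mul, spN_mul, spN_aut, spN_aut, spN_aut, spN_aut, spN_two] at hn
  calc spN ℚ_[2] Z.pi ^ 4 = spN ℚ_[2] Z.pi * spN ℚ_[2] Z.pi * spN ℚ_[2] Z.pi * spN ℚ_[2] Z.pi := by ring
    _ = 2⁻¹ := hn

/-- `‖π‖ > 0`. -/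
theorem Zeta8Data.spN_pi_pos : 0 < spN ℚ_[2] Z.pi := by
  have h := Z.spN_pi_pow_four
  have h0 := spN_nonneg ℚ_[2] Z.pi
  by_contra hle
  have : spN ℚ_[2] Z.pi = 0 := le_antisymm (not_lt.1 hle) h0
  rw [this] at h; norm_num at h

/-- Norms of nonzero `2`-adic numbers are integral powers of `2`. -/
theorem exists_norm_eq_zpow {c : ℚ_[2]} (hc : c ≠ 0) : ∃ a : ℤ, ‖c‖ = (2 : ℝ) ^ a :=
  ⟨-c.valuation, by rw [Padic.norm_eq_zpow_neg_valuation hc]; norm_cast⟩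

/-- DISTINCT EXPONENT CLASSES: `2^a ‖π‖^j = 2^b ‖π‖^j'` with `j, j' < 4` forces `j = j'`. -/
theorem Zeta8Data.eq_of_zpow_mul_pi_pow_eq {a b : ℤ} {j j' : ℕ} (hj : j < 4) (hj' : j' < 4)
    (h : (2 : ℝ) ^ a * spN ℚ_[2] Z.pi ^ j = (2 : ℝ) ^ b * spN ℚ_[2] Z.pi ^ j') : j = j' := by
  have hν := Z.spN_pi_pow_four
  have key : ∀ (a : ℤ) (j : ℕ), ((2 : ℝ) ^ a * spN ℚ_[2] Z.pi ^ j) ^ 4 = (2 : ℝ) ^ (4 * a - (j : ℤ)) := by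
    intro a j
    have h1 : (spN ℚ_[2] Z.pi ^ j) ^ 4 = (2 : ℝ) ^ (-(j : ℤ)) := by
      rw [← pow_mul, mul_comm j 4, pow_mul, hν, inv_pow, zpow_neg, zpow_natCast]
    have h2 : ((2 : ℝ) ^ a) ^ 4 = (2 : ℝ) ^ (4 * a) := by
      rw [← zpow_natCast ((2 : ℝ) ^ a) 4, ← zpow_mul, mul_comm]; norm_num
    rw [mul_pow, h1, h2, ← zpow_add₀ (by norm_num : (2 : ℝ) ≠ 0), sub_eq_add_neg]
  have h4 : ((2 : ℝ) ^ a * spN ℚ_[2] Z.pi ^ j) ^ 4 = ((2 : ℝ) ^ b * spN ℚ_[2] Z.pi ^ j') ^ 4 := by rw [h]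
  rw [key, key] at h4
  have := zpow_right_injective₀ (by norm_num : (0 : ℝ) < 2) (by norm_num : (2 : ℝ) ≠ 1) h4
  omega

/-- A unit of `ℤ₂` is `≡ 1` modulo `2`: `‖e‖ = 1 ⇒ ‖e − 1‖ < 1`. -/
theorem norm_sub_one_lt_of_norm_eq_one {e : ℚ_[2]} (he : ‖e‖ = 1) : ‖e - 1‖ < 1 := by
  obtain ⟨ε, hε, hlt⟩ := TwoAdic.exists_rep_zero_one e he.le
  rcases hε with rfl | rfl
  · rw [sub_zero] at hlt; rw [he] at hlt; exact absurd hlt (lt_irrefl 1)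
  · exact hlt

/-- NORM OF `c + d·y` when `‖y‖ = ‖y − 1‖ = 1`: it is `max ‖c‖ ‖d‖`. -/
theorem spN_coeff_combo {y : Ω} (hy : spN ℚ_[2] y = 1) (hy1 : spN ℚ_[2] (y - 1) = 1) (c d : ℚ_[2]) :
    spN ℚ_[2] (algebraMap ℚ_[2] Ω c + algebraMap ℚ_[2] Ω d * y) = max ‖c‖ ‖d‖ := by
  have hy' : spN ℚ_[2] (1 + y) = 1 := by
    have : (1 : Ω) + y = (y - 1) + 2 := by ring
    rw [this, spN_add_eq_max_of_ne ℚ_[2] (by rw [hy1, spN_two]; norm_num), hy1, spN_two]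
    norm_num
  by_cases hc : c = 0
  · subst hc
    simp only [map_zero, zero_add, norm_zero]
    rw [spN_mul, spN_algebraMap, hy, mul_one, max_eq_right (norm_nonneg d)]
  by_cases hd : d = 0
  · subst hd
    simp only [map_zero, zero_mul, add_zero, norm_zero]
    rw [spN_algebraMap, max_eq_left (norm_nonneg c)]
  have hcpos : 0 < ‖c‖ := norm_pos_iff.2 hc
  have hdpos : 0 < ‖d‖ := norm_pos_iff.2 hd
  have hc' : algebraMap ℚ_[2] Ω c ≠ 0 := (_root_.map_ne_zero _).2 hc
  have hd' : algebraMap ℚ_[2] Ω d ≠ 0 := (_root_.map_ne_zero _).2 hd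
  rcases lt_trichotomy ‖d‖ ‖c‖ with hlt | heq | hgt
  · -- ‖d‖ < ‖c‖ : factor out c
    have : algebraMap ℚ_[2] Ω c + algebraMap ℚ_[2] Ω d * y =
        algebraMap ℚ_[2] Ω c * (1 + algebraMap ℚ_[2] Ω (d / c) * y) := by
      rw [map_div₀]; field_simp
    rw [this, spN_mul, spN_algebraMap, max_eq_left hlt.le]
    have hsmall : spN ℚ_[2] (algebraMap ℚ_[2] Ω (d / c) * y) < 1 := by
      rw [spN_mul, spN_algebraMap, hy, mul_one, norm_div, div_lt_one hcpos]; exact hlt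
    have : spN ℚ_[2] (1 + algebraMap ℚ_[2] Ω (d / c) * y) = 1 := by
      rw [spN_add_eq_max_of_ne ℚ_[2] (by rw [spN_one]; exact (ne_of_lt hsmall).symm), spN_one,
        max_eq_left hsmall.le]
    rw [this, mul_one]
  · -- ‖d‖ = ‖c‖ : d/c is a unit, ≡ 1
    have hunit : ‖d / c‖ = 1 := by rw [norm_div, heq, div_self (ne_of_gt hcpos)]
    have : algebraMap ℚ_[2] Ω c + algebraMap ℚ_[2] Ω d * y =
        algebraMap ℚ_[2] Ω c * ((1 + y) + algebraMap ℚ_[2] Ω (d / c - 1) * y) := by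
      rw [map_sub, map_div₀, map_one]; field_simp; ring
    rw [this, spN_mul, spN_algebraMap, heq, max_self]
    have hsmall : spN ℚ_[2] (algebraMap ℚ_[2] Ω (d / c - 1) * y) < 1 := by
      rw [spN_mul, spN_algebraMap, hy, mul_one]; exact norm_sub_one_lt_of_norm_eq_one hunit
    have : spN ℚ_[2] ((1 + y) + algebraMap ℚ_[2] Ω (d / c - 1) * y) = 1 := by
      rw [spN_add_eq_max_of_ne ℚ_[2] (by rw [hy']; exact (ne_of_lt hsmall).symm), hy', max_eq_left hsmall.le]
    rw [this, mul_one]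
  · -- ‖c‖ < ‖d‖ : factor out d
    have : algebraMap ℚ_[2] Ω c + algebraMap ℚ_[2] Ω d * y =
        algebraMap ℚ_[2] Ω d * (algebraMap ℚ_[2] Ω (c / d) + y) := by
      rw [map_div₀]; field_simp
    rw [this, spN_mul, spN_algebraMap, max_eq_right hgt.le]
    have hsmall : spN ℚ_[2] (algebraMap ℚ_[2] Ω (c / d)) < 1 := by
      rw [spN_algebraMap, norm_div, div_lt_one hdpos]; exact hgt
    have : spN ℚ_[2] (algebraMap ℚ_[2] Ω (c / d) + y) = 1 := by
      rw [spN_add_eq_max_of_ne ℚ_[2] (by rw [hy]; exact ne_of_lt hsmall), hy, max_eq_right hsmall.le]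
    rw [this, mul_one]

omit [CharZero Ω] in
/-- ULTRAMETRIC SUM WITH A STRICT MAXIMUM: if one term strictly dominates all others, the sum has its norm. -/
theorem spN_sum_eq_of_dominant {ι : Type*} (s : Finset ι) (t : ι → Ω) (j₀ : ι) (hj₀ : j₀ ∈ s)
    (hdom : ∀ j ∈ s, j ≠ j₀ → spN ℚ_[2] (t j) < spN ℚ_[2] (t j₀)) :
    spN ℚ_[2] (∑ j ∈ s, t j) = spN ℚ_[2] (t j₀) := by
  classical
  have hrest : ∀ (s' : Finset ι), (∀ j ∈ s', j ≠ j₀ ∧ spN ℚ_[2] (t j) < spN ℚ_[2] (t j₀)) →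
      s'.Nonempty → spN ℚ_[2] (∑ j ∈ s', t j) < spN ℚ_[2] (t j₀) := by
    intro s' hs' hne
    induction s' using Finset.induction_on with
    | empty => exact absurd hne (Finset.not_nonempty_empty)
    | insert a s' ha ih =>
      rw [Finset.sum_insert ha]
      by_cases hs'e : s'.Nonempty
      · have h1 := (hs' a (Finset.mem_insert_self a s')).2
        have h2 := ih (fun j hj => hs' j (Finset.mem_insert_of_mem hj)) hs'e
        exact (spN_add_le ℚ_[2] _ _).trans_lt (max_lt h1 h2)
      · rw [Finset.not_nonempty_iff_eq_empty.1 hs'e, Finset.sum_empty, add_zero]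
        exact (hs' a (Finset.mem_insert_self a s')).2
  rw [← Finset.add_sum_erase s t hj₀]
  by_cases hne : (s.erase j₀).Nonempty
  · have hlt := hrest (s.erase j₀) (fun j hj => ⟨Finset.ne_of_mem_erase hj, hdom j (Finset.mem_of_mem_erase hj)
      (Finset.ne_of_mem_erase hj)⟩) hne
    rw [spN_add_eq_max_of_ne ℚ_[2] (ne_of_gt hlt), max_eq_left hlt.le]
  · rw [Finset.not_nonempty_iff_eq_empty.1 hne, Finset.sum_empty, add_zero]

/-- MAIN LEMMA (residues of `ℚ₂(√2, i)` are `0` or `1`): for `y = a + b s2 + c I + d s2 I` of norm `≤ 1`,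
`‖y‖ < 1` or `‖y − 1‖ < 1`. -/
theorem Zeta8Data.spN_lt_or_sub_one_lt (w : Fin 4 → ℚ_[2]) (hw : spN ℚ_[2] (Z.ev w) ≤ 1) :
    spN ℚ_[2] (Z.ev w) < 1 ∨ spN ℚ_[2] (Z.ev w - 1) < 1 := by
  classical
  by_contra hcon
  push Not at hcon
  obtain ⟨h1, h2⟩ := hcon
  set y := Z.ev w with hy_def
  have hy : spN ℚ_[2] y = 1 := le_antisymm hw h1
  have hy1 : spN ℚ_[2] (y - 1) = 1 := by
    refine le_antisymm ?_ h2
    calc spN ℚ_[2] (y - 1) ≤ max (spN ℚ_[2] y) (spN ℚ_[2] 1) := spN_sub_le ℚ_[2] y 1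
      _ = 1 := by rw [hy, spN_one, max_self]
  -- eight coefficient vectors in `ℚ₂⁴`
  let e0 : Fin 4 → ℚ_[2] := ![1, 0, 0, 0]
  have hev0 : Z.ev e0 = 1 := by simp [Zeta8Data.ev, e0]
  let vec : Fin 2 × Fin 4 → (Fin 4 → ℚ_[2]) := fun p =>
    if p.1 = 0 then mulPi8^[p.2.val] e0 else mulPi8^[p.2.val] w
  have hev : ∀ p : Fin 2 × Fin 4, Z.ev (vec p) =
      (if p.1 = 0 then (1 : Ω) else y) * Z.pi ^ p.2.val := by
    rintro ⟨i, j⟩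
    by_cases hi : i = 0
    · simp only [vec, hi, if_true]
      rw [Zeta8Data.ev_mulPi_iterate, hev0]
    · simp only [vec, hi, if_false]
      rw [Zeta8Data.ev_mulPi_iterate]
  -- they are linearly dependent: card 8 > finrank 4
  have hdep : ¬ LinearIndependent ℚ_[2] vec := by
    intro hli
    have := hli.fintype_card_le_finrank
    simp at this
  rw [Fintype.not_linearIndependent_iff] at hdep
  obtain ⟨g, hg0, ⟨p₀, hp₀⟩⟩ := hdep
  -- apply `ev`
  have hsum : ∑ p, algebraMap ℚ_[2] Ω (g p) * Z.ev (vec p) = 0 := by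
    rw [← Zeta8Data.ev_sum]; rw [hg0]; simp [Zeta8Data.ev]
  -- regroup by the power of π: S j = g(0,j) + g(1,j) y
  let S : Fin 4 → Ω := fun j => algebraMap ℚ_[2] Ω (g (0, j)) + algebraMap ℚ_[2] Ω (g (1, j)) * y
  have hregroup : ∑ p, algebraMap ℚ_[2] Ω (g p) * Z.ev (vec p) = ∑ j, S j * Z.pi ^ j.val := by
    rw [Fintype.sum_prod_type, Fin.sum_univ_two]
    rw [← Finset.sum_add_distrib]
    refine Finset.sum_congr rfl fun j _ => ?_
    rw [hev (0, j), hev (1, j)]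
    simp only [if_true, show (1 : Fin 2) ≠ 0 from by decide, if_false, S]
    ring
  rw [hregroup] at hsum
  -- norms of the S j
  have hS : ∀ j, spN ℚ_[2] (S j) = max ‖g (0, j)‖ ‖g (1, j)‖ := fun j => spN_coeff_combo hy hy1 _ _
  -- the index p₀ gives a nonzero S
  have hSne : ∃ j, S j ≠ 0 := by
    refine ⟨p₀.2, fun h0 => ?_⟩
    have := hS p₀.2
    rw [h0, spN_zero] at this
    have hmax : max ‖g (0, p₀.2)‖ ‖g (1, p₀.2)‖ = 0 := this.symm
    have hle0 : ‖g (0, p₀.2)‖ ≤ 0 := by rw [← hmax]; exact le_max_left _ _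
    have hle1 : ‖g (1, p₀.2)‖ ≤ 0 := by rw [← hmax]; exact le_max_right _ _
    have g0 : g (0, p₀.2) = 0 := norm_le_zero_iff.1 hle0
    have g1 : g (1, p₀.2) = 0 := norm_le_zero_iff.1 hle1
    rcases p₀ with ⟨i, j⟩
    fin_cases i
    · exact hp₀ g0
    · exact hp₀ g1
  -- pick the dominant term
  obtain ⟨j₀, -, hj₀max⟩ := Finset.exists_max_image Finset.univ (fun j : Fin 4 => spN ℚ_[2] (S j * Z.pi ^ j.val))
    Finset.univ_nonempty
  have hterm : ∀ j, spN ℚ_[2] (S j * Z.pi ^ j.val) = max ‖g (0, j)‖ ‖g (1, j)‖ * spN ℚ_[2] Z.pi ^ j.val := by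
    intro j; rw [spN_mul, spN_pow, hS]
  have hj₀ne : S j₀ ≠ 0 := by
    obtain ⟨j₁, hj₁⟩ := hSne
    intro h0
    have hle := hj₀max j₁ (Finset.mem_univ _)
    rw [h0, zero_mul, spN_zero] at hle
    have hpos : 0 < spN ℚ_[2] (S j₁ * Z.pi ^ j₁.val) := by
      rw [spN_mul, spN_pow]
      exact mul_pos (spN_pos_of_ne_zero ℚ_[2] hj₁) (pow_pos Z.spN_pi_pos _)
    exact absurd hle (not_le.2 hpos)
  have hdom : ∀ j ∈ (Finset.univ : Finset (Fin 4)), j ≠ j₀ →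
      spN ℚ_[2] (S j * Z.pi ^ j.val) < spN ℚ_[2] (S j₀ * Z.pi ^ j₀.val) := by
    intro j _ hjne
    rcases (hj₀max j (Finset.mem_univ _)).lt_or_eq with hlt | heq
    · exact hlt
    · exfalso
      -- equal norms with j ≠ j₀ contradict the distinct exponent classes (both S nonzero)
      have hSj : S j ≠ 0 := by
        intro h0; rw [h0, zero_mul, spN_zero] at heq
        have hpos : 0 < spN ℚ_[2] (S j₀ * Z.pi ^ j₀.val) := by
          rw [spN_mul, spN_pow]; exact mul_pos (spN_pos_of_ne_zero ℚ_[2] hj₀ne) (pow_pos Z.spN_pi_pos _)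
        rw [← heq] at hpos; exact lt_irrefl _ hpos
      -- the max norms are norms of nonzero 2-adic numbers, hence powers of 2
      have hm : ∀ j', S j' ≠ 0 → ∃ a : ℤ, max ‖g (0, j')‖ ‖g (1, j')‖ = (2 : ℝ) ^ a := by
        intro j' hj'
        by_cases hle : ‖g (1, j')‖ ≤ ‖g (0, j')‖
        · rw [max_eq_left hle]
          have : g (0, j') ≠ 0 := by
            intro h0
            rw [h0, norm_zero] at hle
            have g1 : g (1, j') = 0 := norm_le_zero_iff.1 hle
            apply hj'; simp only [S, h0, g1, map_zero, zero_mul, add_zero]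
          exact exists_norm_eq_zpow this
        · rw [max_eq_right (not_le.1 hle).le]
          have : g (1, j') ≠ 0 := by
            intro h0; rw [h0, norm_zero] at hle; exact hle (norm_nonneg _)
          exact exists_norm_eq_zpow this
      obtain ⟨a, ha⟩ := hm j hSj
      obtain ⟨b, hb⟩ := hm j₀ hj₀ne
      rw [hterm, hterm, ha, hb] at heq
      exact hjne (Fin.ext (Z.eq_of_zpow_mul_pi_pow_eq j.isLt j₀.isLt heq))
  have hnorm := spN_sum_eq_of_dominant Finset.univ (fun j : Fin 4 => S j * Z.pi ^ j.val) j₀ (Finset.mem_univ _) hdom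
  rw [hsum, spN_zero] at hnorm
  have hpos : 0 < spN ℚ_[2] (S j₀ * Z.pi ^ j₀.val) := by
    rw [spN_mul, spN_pow]; exact mul_pos (spN_pos_of_ne_zero ℚ_[2] hj₀ne) (pow_pos Z.spN_pi_pos _)
  rw [← hnorm] at hpos
  exact lt_irrefl _ hpos

/-- Residue form: an element `a + b s2 + c I + d s2 I` of the unit ball has residue `0` or `1`. -/
theorem Zeta8Data.resid_zero_or_one (w : Fin 4 → ℚ_[2]) (hw : Z.ev w ∈ ball ℚ_[2] Ω) :
    resid ℚ_[2] Ω ⟨Z.ev w, hw⟩ = 0 ∨ resid ℚ_[2] Ω ⟨Z.ev w, hw⟩ = 1 := by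
  rcases Z.spN_lt_or_sub_one_lt w hw with h0 | h1
  · left; rw [resid_eq_zero_iff]; exact h0
  · right
    rw [← map_one (resid ℚ_[2] Ω), resid_eq_iff]
    simpa using h1

end Summit.Ventures.DiscreteObjects.UnitDistance.MoserLocal
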